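import Literature.AlgebraicGeometry.HodgeTheory.QbarFamilyLocalSystem
import Literature.AlgebraicGeometry.HodgeTheory.FlatSectionNonvanishing
import Literature.AlgebraicGeometry.HodgeTheory.TopDegreeClasses
import Literature.AlgebraicGeometry.Motives.MotivatedCyclesAbelianPencilPieces
import Literature.AlgebraicGeometry.Motives.VarietiesProperProofs
import HarnessLib

/-!
# Ring 2 · sub-cell AbelianAll (ALL ABELIAN VARIETIES), André axis, part L-c — THE INVARIANT RANK DATA OF ONE MEMBER HOLD AT EVERY MEMBER:
# the images `j_s^* H^k(𝒳)` of the restriction maps of a compact abelian pencil are carried onto each other by parallel transport, so the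
# rank hypotheses of the `B⋆` rows («rank-one invariants off the middle», «no odd invariants», «middle invariants spanned by θⁿ, w₊, w₋»),
# displayed at the charted member `t`, are POINT-INDEPENDENT

HONEST FRAMING (page 1, verbatim): **research route, not a corollary; conditional on HC_CM plus one named
minimal statement.** Cell line: research route conditional on HC_CM; not a corollary; Q11.4-sentence-2
already refuted in dim ≥ 3. Nothing in this file proves a case of the Hodge conjecture or of `B(X)` for a named `X`; nothing is Hodge-theoretic.
`HC_CM`, `HC_AV`, the global nodes, Verdier's binder: ABSENT. Item `Theses.RankFourFaces.CMToAbelian` (stmt-16267) stays OPEN; N104 untouched; no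
node is born (0 `def`, 0 `sorry`, no named fact). Seat `pub-hodge-ring2-ab-andre-2`, gen 42 (part L; companion of parts L-a/L-b).

## Content (theorems only; standard axioms)

* §1 (over a cohomologically locally trivial `U`, along a homotopy class of paths `γ` from `s` to `t`) **`range_map_fiberι_eq_map_transport`** —
  `j_t^* H^k(𝒳) = γ_* (j_s^* H^k(𝒳))` (restrictions of global classes are flat, `transportFun_map_fiberι`); **`finrank_range_map_fiberι_eq_of_transport`**
  — hence `dim j_s^* H^k(𝒳) = dim j_t^* H^k(𝒳)` (`γ_*` is injective); **`forall_map_fiberι_eq_zero_iff_of_transport`** — `j_s^* = 0 ⟺ j_t^* = 0` on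
  `H^k(𝒳)`; **`exists_span_three_of_transport`** — if `j_s^* H^k(𝒳)` is spanned by the restrictions of three global classes then so is `j_t^* H^k(𝒳)`,
  with the SAME coefficients for each global class.
* §2 (compact abelian pencils `IsCompactAbelianPencil f d`, any two members `s`, `t`; Ehresmann on complex points and path-connectedness of `S(ℂ)`)
  **`finrank_range_map_fiberι_member_eq`**, **`forall_map_fiberι_member_eq_zero_iff`**, **`exists_span_three_member`** — the three rank hypotheses
  `hRank` / `hOdd` / `hspan` of the `B⋆` rows (parts XL-c, XLVII-g, XLVIII-c, XLIX-b, L-b) transfer verbatim from one member to any other.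

## Honest status

Bookkeeping: the charted point `t` of the `B⋆` rows is immaterial for their RANK hypotheses (as it is for the discriminant datum, part L-a); what does
NOT transfer topologically is Hodge TYPE (Weil type of the members, algebraicity of `θ'` at `t`). Strength of the open instance unchanged; nothing
minimal is claimed; N104 untouched. EDGE LABELS: §1–§2 K (fact-free).
References: VoisinHodgeI2002 (Thm. 9.3, §9.2.1); VoisinHodgeII2003 (§3.1.2, §4.3.1); Deligne1971HodgeII (Thm. 4.1.1, the easy inclusion).
-/

noncomputable section

set_option linter.dupNamespace false

namespace Summit.HodgeConjecture.HodgeConjecture.Ring2.AbelianAll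

open CategoryTheory AlgebraicGeometry
open _root_.Topology _root_.Filter
open Literature.AlgebraicGeometry Literature.AlgebraicGeometry.Motives
open Literature.AlgebraicGeometry.HodgeTheory

/-! ## §1 Along a path: the images of the restriction maps correspond under transport -/

section Transport

variable {𝒳 S : SchemeOver ℂ} (π : 𝒳 ⟶ S) (k : ℕ) {U : Set (ComplexPoints S)}

/-- **`j_t^* H^k(𝒳) = γ_* (j_s^* H^k(𝒳))`**: transport along `γ` carries the image of the restriction map at `s` ONTO the image at `t`
(restrictions of global classes are flat sections: `γ_*(A|X_s) = A|X_t`). [cite: VoisinHodgeII2003, §3.1.2] -/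
theorem range_map_fiberι_eq_map_transport (hU : IsCohomologicallyLocallyTrivialOn π U) {s t : U} (γ : Path.Homotopic.Quotient s t) :
    LinearMap.range (complexBetti.map (fiberι π t.1) k).hom =
      (LinearMap.range (complexBetti.map (fiberι π s.1) k).hom).map (transportLinear π k hU γ) := by
  ext x
  constructor
  · rintro ⟨W, rfl⟩
    exact ⟨complexBetti.map (fiberι π s.1) k W, ⟨W, rfl⟩, transportFun_map_fiberι π k hU γ W⟩
  · rintro ⟨y, ⟨W, rfl⟩, rfl⟩
    exact ⟨W, (transportFun_map_fiberι π k hU γ W).symm⟩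

/-- **The rank of the invariants is constant**: `dim j_s^* H^k(𝒳) = dim j_t^* H^k(𝒳)` for `s`, `t` joined by a path in `U` (transport is an
injective linear map carrying one image onto the other). [cite: VoisinHodgeII2003, §3.1.2] -/
theorem finrank_range_map_fiberι_eq_of_transport (hU : IsCohomologicallyLocallyTrivialOn π U) {s t : U} (γ : Path.Homotopic.Quotient s t) :
    Module.finrank ℂ (LinearMap.range (complexBetti.map (fiberι π s.1) k).hom) =
      Module.finrank ℂ (LinearMap.range (complexBetti.map (fiberι π t.1) k).hom) := by
  rw [range_map_fiberι_eq_map_transport π k hU γ]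
  exact LinearEquiv.finrank_eq
    (Submodule.equivMapOfInjective (transportLinear π k hU γ) (transportFun_injective π k hU γ) _)

/-- **`j_s^* = 0 ⟺ j_t^* = 0` on `H^k(𝒳)`** for `s`, `t` joined by a path in `U`. [cite: VoisinHodgeII2003, §3.1.2] -/
theorem forall_map_fiberι_eq_zero_iff_of_transport (hU : IsCohomologicallyLocallyTrivialOn π U) {s t : U} (γ : Path.Homotopic.Quotient s t) :
    (∀ W : complexBetti 𝒳 k, complexBetti.map (fiberι π s.1) k W = 0) ↔
      ∀ W : complexBetti 𝒳 k, complexBetti.map (fiberι π t.1) k W = 0 := by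
  constructor
  · intro h W
    rw [← transportFun_map_fiberι π k hU γ W, h W, transportFun_zero]
  · intro h W
    rw [← transportFun_map_fiberι π k hU γ.symm W, h W, transportFun_zero]

/-- **Spanning triples transfer with the same coefficients**: if every restriction `j_s^* W` is `a·j_s^*Θ + b·j_s^*U + c·j_s^*V` then
`j_t^* W = a·j_t^*Θ + b·j_t^*U + c·j_t^*V` with the SAME `a, b, c` (apply `γ_*`, linear and flat on restrictions).
[cite: VoisinHodgeII2003, §3.1.2] -/
theorem exists_span_three_of_transport (hU : IsCohomologicallyLocallyTrivialOn π U) {s t : U} (γ : Path.Homotopic.Quotient s t) (Θ U₁ V : complexBetti 𝒳 k)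
    (hspan : ∀ W : complexBetti 𝒳 k, ∃ a b c : ℂ, (complexBetti.map (fiberι π s.1) k).hom W =
      a • (complexBetti.map (fiberι π s.1) k).hom Θ + b • (complexBetti.map (fiberι π s.1) k).hom U₁ +
        c • (complexBetti.map (fiberι π s.1) k).hom V)
    (W : complexBetti 𝒳 k) :
    ∃ a b c : ℂ, (complexBetti.map (fiberι π t.1) k).hom W =
      a • (complexBetti.map (fiberι π t.1) k).hom Θ + b • (complexBetti.map (fiberι π t.1) k).hom U₁ +
        c • (complexBetti.map (fiberι π t.1) k).hom V := by
  obtain ⟨a, b, c, h⟩ := hspan W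
  refine ⟨a, b, c, ?_⟩
  have hT := congrArg (transportLinear π k hU γ) h
  simp only [map_add, map_smul, transportLinear_apply] at hT
  change transportFun π k hU γ (complexBetti.map (fiberι π s.1) k W) =
    a • transportFun π k hU γ (complexBetti.map (fiberι π s.1) k Θ) + b • transportFun π k hU γ (complexBetti.map (fiberι π s.1) k U₁) +
      c • transportFun π k hU γ (complexBetti.map (fiberι π s.1) k V) at hT
  simpa only [transportFun_map_fiberι] using hT

end Transport

/-! ## §2 Compact abelian pencils: the rank hypotheses of the `B⋆` rows transfer between any two members -/

section Pencil

variable {𝒳 S : SchemeOver ℂ}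

/-- Any two complex points of a smooth connected base are joined by a path (a connected manifold is path connected), so a conclusion drawn
from a homotopy class of paths `γ : s ⇝ t` in `univ` holds for all `s`, `t`. [cite: VoisinHodgeI2002, §9.2.1] -/
theorem forall_of_path_univ (S : SchemeOver ℂ) (m : ℕ) [SmoothOfRelativeDimension m S.hom] [LocallyOfFiniteType S.hom]
    [ConnectedSpace (ComplexPoints S)] {P : ComplexPoints S → ComplexPoints S → Prop}
    (h : ∀ (s t : (Set.univ : Set (ComplexPoints S))) (_ : Path.Homotopic.Quotient s t), P s.1 t.1) (s t : ComplexPoints S) : P s t := by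
  haveI := pathConnectedSpace_complexPoints_of_smoothOfRelativeDimension S m
  have hcont : Continuous fun x : ComplexPoints S => (⟨x, Set.mem_univ x⟩ : (Set.univ : Set (ComplexPoints S))) :=
    continuous_id.subtype_mk _
  exact h ⟨s, Set.mem_univ s⟩ ⟨t, Set.mem_univ t⟩ ⟦(PathConnectedSpace.somePath s t).map hcont⟧

/-- **«Rank-`r` invariants» transfers**: on a compact abelian pencil, `dim j_s^* H^k(𝒳) = dim j_t^* H^k(𝒳)` for ANY two members — in particular the
hypothesis `hRank` of the `B⋆` rows (rank ONE off the middle degree at the charted member) holds at every member once it holds at one.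
[cite: VoisinHodgeII2003, §3.1.2] [cite: VoisinHodgeI2002, Thm. 9.3 and §9.2.1] -/
theorem finrank_range_map_fiberι_member_eq {f : 𝒳 ⟶ S} {d : ℕ} (hf : IsCompactAbelianPencil f d) (k : ℕ) (s t : ComplexPoints S) :
    Module.finrank ℂ (LinearMap.range (complexBetti.map (fiberι f s) k).hom) =
      Module.finrank ℂ (LinearMap.range (complexBetti.map (fiberι f t) k).hom) := by
  haveI : IsProper S.hom := IsSmoothProjective.isProper_holds hf.isSmoothProjective_base
  haveI : CompactSpace S.left := QuasiCompact.compactSpace_of_compactSpace S.hom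
  haveI := hf.isSmoothProjective_base.smoothOfRelativeDimension
  haveI : IsProper f.left := hf.isSmoothProjectiveFamily.isProper
  haveI := hf.isSmoothProjectiveFamily.smoothOfRelativeDimension
  haveI := connectedSpace_complexPoints hf.isSmoothProjective_base
  exact forall_of_path_univ S 1 (P := fun s t => Module.finrank ℂ (LinearMap.range (complexBetti.map (fiberι f s) k).hom) =
      Module.finrank ℂ (LinearMap.range (complexBetti.map (fiberι f t) k).hom))
    (fun s' t' γ => finrank_range_map_fiberι_eq_of_transport f k (isCohomologicallyLocallyTrivialOn_univ f d 1) γ) s t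

/-- **«No invariants in degree `k`» transfers**: on a compact abelian pencil, `j_s^* = 0` on `H^k(𝒳)` iff `j_t^* = 0` on `H^k(𝒳)` for any two members —
the hypothesis `hOdd` of the `B⋆` rows at every member from one. [cite: VoisinHodgeII2003, §3.1.2] [cite: VoisinHodgeI2002, Thm. 9.3 and §9.2.1] -/
theorem forall_map_fiberι_member_eq_zero_iff {f : 𝒳 ⟶ S} {d : ℕ} (hf : IsCompactAbelianPencil f d) (k : ℕ) (s t : ComplexPoints S) :
    (∀ W : complexBetti 𝒳 k, complexBetti.map (fiberι f s) k W = 0) ↔ ∀ W : complexBetti 𝒳 k, complexBetti.map (fiberι f t) k W = 0 := by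
  haveI : IsProper S.hom := IsSmoothProjective.isProper_holds hf.isSmoothProjective_base
  haveI : CompactSpace S.left := QuasiCompact.compactSpace_of_compactSpace S.hom
  haveI := hf.isSmoothProjective_base.smoothOfRelativeDimension
  haveI : IsProper f.left := hf.isSmoothProjectiveFamily.isProper
  haveI := hf.isSmoothProjectiveFamily.smoothOfRelativeDimension
  haveI := connectedSpace_complexPoints hf.isSmoothProjective_base
  exact forall_of_path_univ S 1 (P := fun s t => (∀ W : complexBetti 𝒳 k, complexBetti.map (fiberι f s) k W = 0) ↔
      ∀ W : complexBetti 𝒳 k, complexBetti.map (fiberι f t) k W = 0)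
    (fun s' t' γ => forall_map_fiberι_eq_zero_iff_of_transport f k (isCohomologicallyLocallyTrivialOn_univ f d 1) γ) s t

/-- **«The middle invariants are spanned by `θⁿ`, `w₊`, `w₋`» transfers**: on a compact abelian pencil, if every `j_s^* W` (`W ∈ H^k(𝒳)`) is a combination
of the restrictions of three global classes `Θ, U₊, U₋` at ONE member `s`, then so is every `j_t^* W` at ANY member `t`, with the same coefficients —
the hypothesis `hspan` of the `B⋆` rows at every member from one. [cite: VoisinHodgeII2003, §3.1.2] [cite: VoisinHodgeI2002, Thm. 9.3 and §9.2.1] -/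
theorem exists_span_three_member {f : 𝒳 ⟶ S} {d : ℕ} (hf : IsCompactAbelianPencil f d) (k : ℕ) (Θ Up Um : complexBetti 𝒳 k)
    (s t : ComplexPoints S)
    (hspan : ∀ W : complexBetti 𝒳 k, ∃ a b c : ℂ, (complexBetti.map (fiberι f s) k).hom W =
      a • (complexBetti.map (fiberι f s) k).hom Θ + b • (complexBetti.map (fiberι f s) k).hom Up +
        c • (complexBetti.map (fiberι f s) k).hom Um)
    (W : complexBetti 𝒳 k) :
    ∃ a b c : ℂ, (complexBetti.map (fiberι f t) k).hom W =
      a • (complexBetti.map (fiberι f t) k).hom Θ + b • (complexBetti.map (fiberι f t) k).hom Up +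
        c • (complexBetti.map (fiberι f t) k).hom Um := by
  haveI : IsProper S.hom := IsSmoothProjective.isProper_holds hf.isSmoothProjective_base
  haveI : CompactSpace S.left := QuasiCompact.compactSpace_of_compactSpace S.hom
  haveI := hf.isSmoothProjective_base.smoothOfRelativeDimension
  haveI : IsProper f.left := hf.isSmoothProjectiveFamily.isProper
  haveI := hf.isSmoothProjectiveFamily.smoothOfRelativeDimension
  haveI := connectedSpace_complexPoints hf.isSmoothProjective_base
  revert W
  exact forall_of_path_univ S 1 (P := fun s t =>
      (∀ W : complexBetti 𝒳 k, ∃ a b c : ℂ, (complexBetti.map (fiberι f s) k).hom W =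
        a • (complexBetti.map (fiberι f s) k).hom Θ + b • (complexBetti.map (fiberι f s) k).hom Up +
          c • (complexBetti.map (fiberι f s) k).hom Um) →
      ∀ W : complexBetti 𝒳 k, ∃ a b c : ℂ, (complexBetti.map (fiberι f t) k).hom W =
        a • (complexBetti.map (fiberι f t) k).hom Θ + b • (complexBetti.map (fiberι f t) k).hom Up +
          c • (complexBetti.map (fiberι f t) k).hom Um)
    (fun s' t' γ h => exists_span_three_of_transport f k (isCohomologicallyLocallyTrivialOn_univ f d 1) γ Θ Up Um h) s t hspan

end Pencil

end Summit.HodgeConjecture.HodgeConjecture.Ring2.AbelianAll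

end
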